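import Literature.Geometry.Kaehler.ComplexTorusTotalLieAlgebraRealJordanLefschetzPair
import Literature.Geometry.Kaehler.ComplexTorusNeronSeveriLieAlgebra
import HarnessLib

/-!
# Looijenga–Lunts (3.6) over `ℝ`: "The Néron–Severi Lie algebra of the abelian variety `X` is of Jordan type" — `(𝔤_NS(X; ℝ), h)` is a Jordan–Lefschetz pair

Topic `Literature/Geometry/Kaehler` (namespace `Literature.Geometry.Kaehler.ComplexTorus`, continued).  Lane
`lit-hodgefound` (Track 2 foundations library), skeleton seat `lit-hodgefound-skel-1` (generation 52), row **A1-212** of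
`run/shared/lean/pub/lit-hodgefound/SKELETON.md`.  The tree defines the real Néron–Severi Lie algebra
`𝔤_NS(X; ℝ) = 𝔤(NS(X) ⊗ ℝ, H•(X))` of a complex torus `X = V/Φ(ℤ^ι)` (`neronSeveriLieAlgebra Φ = llAlgebra E (neronSeveriR Φ)`:
the real Lie subalgebra of `𝔤𝔩(H•(X, ℂ))` generated by the `e_a = L_a`, `a ∈ NS(X) ⊗ ℝ`, and the partners `f_a` of the
`a` with the Lefschetz property), proves it semisimple for a polarised abelian variety
(`IsRiemannForm.isSemisimple_neronSeveriLieAlgebra`) and `𝔤_NS(X; ℝ) ⊆ 𝔤_tot(X; ℝ)`; row A1-85 proved that the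
`ℚ`-form `(𝔤_NS(X; ℚ), h)` is a Jordan–Lefschetz pair.  This file proves (3.6)'s first sentence for the REAL Lie algebra:

* **`(𝔤_NS(X; ℝ), h)` is a Jordan–Lefschetz pair over `ℝ`** (`Literature.Algebra.Lie.IsJordanLefschetzPair ℝ`, row A1-84)
  for every complex torus with a Riemann form `η₀` — i.e. every polarised abelian variety
  (`IsRiemannForm.isJordanLefschetzPair_neronSeveriLieAlgebra`; `IsAbelianVariety.exists_isJordanLefschetzPair_…`):
  semisimple; `𝔤_4 = 0` is inherited from `𝔤_tot(X; ℝ)` (row A1-211), so `𝔞 = 𝔤_2` is abelian; the polarisation gives the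
  triple `(L_{η₀}, h, Λ_{η₀})` INSIDE `𝔤_NS` (`η₀ ∈ NS(X) ⊗ ℝ` is non-degenerate); and generation by `𝔤_2 ∪ f(dom f)` is
  the very definition of `𝔤(NS(X) ⊗ ℝ, H•(X))`.

THEOREMS ONLY (no definition, no named fact, no `sorry`; net debt `0`); no local instance attribute (`letI` inside proofs;
statements live in `↥𝔤_NS`).

## Source, VERBATIM

E. Looijenga, V. A. Lunts, *A Lie algebra attached to a projective variety*, Invent. Math. **129** (1997) 361–412 (held
TeX `paper:arxiv-alg-geom_9604014`), (3.6) Proposition, p. 14 L70–L76: "The Néron–Severi Lie algebra of the abelian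
variety `X` is of Jordan type.  Its degree `2` summand is canonically isomorphic to `NS(X) ⊗ ℚ`.  Its degree `0` summand
can be identified with the Lie ideal of `End⁰(X)` that is generated by `End⁰(X)^+` and this isomorphism makes `h`
correspond to a scalar operator in `End⁰(X)`.  Moreover, `End⁰(X) = 𝔤_NS(X; ℚ)_0 × 𝔲𝔣(X)`."; proof, L78–L80: "We only
prove the last two assertions, as the others just sum up the preceding discussion.  For a Jordan pair `(𝔤, h)`,
`[𝔤_2, 𝔤_{-2}]` generates `𝔤_0` …"; §1 (1.1) p. 4 L34–L37 ("We let `𝔤(𝔞, M)` denote the Lie subalgebra of `𝔤𝔩(M)`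
generated by the transformations `e_a, f_a`"), (1.9) ("take for `𝔞` the Néron–Severi group … the Néron–Severi Lie
algebra"); §1 p. 7 L54–L78; §2 p. 9 L109–L111.

## Contents (all proved)

* §1 `IsRiemannForm.mem_neronSeveriR'` (`η₀ ∈ NS(X) ⊗ ℝ`), `IsRiemannForm.nondegenerate''`,
  `IsRiemannForm.countingG_mem_neronSeveriLieAlgebra'` (`h = [L_{η₀}, Λ_{η₀}] ∈ 𝔤_NS(X; ℝ)`);
* §2 **`IsRiemannForm.adDegree_neronSeveriLieAlgebra_eq_bot`** (`𝔤_c(h) = 0`, `c ∉ {-2, 0, 2}`),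
  **`IsRiemannForm.lie_eq_zero_of_mem_adDegree_two_neronSeveriLieAlgebra`** (`𝔤_2` abelian);
* §3 `IsRiemannForm.lefschetzG_mem_adDegree_two_neronSeveriLieAlgebra` (`L_η ∈ 𝔤_2` for `η ∈ NS(X) ⊗ ℝ`),
  `IsRiemannForm.isSl2Triple_neronSeveriLieAlgebra`, `IsRiemannForm.lefschetzG_mem_lefschetzDomain_neronSeveriLieAlgebra`;
* §4 **`IsRiemannForm.lieSpan_adDegree_two_union_lefschetzDuals_neronSeveriLieAlgebra`** (generation),
  **`IsRiemannForm.isJordanLefschetzPair_neronSeveriLieAlgebra`**, `IsRiemannForm.isLefschetzPair_neronSeveriLieAlgebra`,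
  **`IsAbelianVariety.exists_isJordanLefschetzPair_neronSeveriLieAlgebra`**.

## SCOPE (what is NOT formalised here)

The remaining clauses of (3.6) — `𝔤_2 ≅ NS(X) ⊗ ℚ`, `𝔤_0 =` the Lie ideal of `End⁰(X)` generated by `End⁰(X)^+`,
`End⁰(X) = 𝔤_NS(X; ℚ)_0 × 𝔲𝔣(X)` — are rows A1-54 … A1-70's business (over `ℚ`/`ℝ` in the tree's `…NeronSeveriLieAlgebra*`
files) and are not restated.  Nothing here concerns the Hodge conjecture.

## References

* [LooijengaLunts1997] E. Looijenga, V. A. Lunts, *A Lie algebra attached to a projective variety*, Invent. Math. 129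
  (1997) 361–412; arXiv:alg-geom/9604014. §1 (1.1), (1.9), p. 7; §2 p. 9; §3 (3.6) p. 14 (held `paper:arxiv-alg-geom_9604014`).
-/

namespace Literature.Geometry.Kaehler.ComplexTorus

open Module Function Literature.Algebra.Lie Literature.LinearAlgebra.Alternating

variable {ι : Type*} {E : Type*} [NormedAddCommGroup E] [NormedSpace ℂ E]
  [FiniteDimensional ℂ E] [Nontrivial E] (Φ : (ι → ℝ) ≃L[ℝ] E) {η₀ : E [⋀^Fin 2]→L[ℝ] ℝ}

/-! ### §1 A polarisation `η₀` puts `h = [L_{η₀}, Λ_{η₀}]` in `𝔤_NS(X; ℝ)` -/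

omit [FiniteDimensional ℂ E] [Nontrivial E] in
/-- A Riemann form is a real Néron–Severi class: `η₀ ∈ NS(X) ⊗ ℝ`. [cite: LooijengaLunts1997, §3 p. 14 L29–L30 ("NS(X) ⊗ ℚ may be identified with the J-invariants in ∧²V^* intersected with ∧²V_ℚ^*")] -/
theorem IsRiemannForm.mem_neronSeveriR' (hη₀ : IsRiemannForm Φ η₀) : η₀ ∈ neronSeveriR Φ :=
  mem_neronSeveriR_of_mem Φ (mem_neronSeveriQ_of_isNSForm Φ (hη₀.isNSForm Φ))

omit [FiniteDimensional ℂ E] [Nontrivial E] in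
/-- A Riemann form has the Lefschetz property (it is non-degenerate). [cite: LooijengaLunts1997, §1 (1.1) p. 4 L1–L5] -/
theorem IsRiemannForm.nondegenerate'' (hη₀ : IsRiemannForm Φ η₀) : ∀ v : E, v ≠ 0 → ∃ w : E, η₀ ![v, w] ≠ 0 := by
  intro v hv
  by_contra h
  simp only [ne_eq, not_exists, not_not] at h
  exact hv (hη₀.nondegenerate v h)

/-- `h ∈ 𝔤_NS(X; ℝ)` for a polarised abelian variety (`h = [L_{η₀}, Λ_{η₀}]`). [cite: LooijengaLunts1997, §1 (1.1) p. 4 L34–L37, §3 (3.6)] -/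
theorem IsRiemannForm.countingG_mem_neronSeveriLieAlgebra' (hη₀ : IsRiemannForm Φ η₀) :
    countingG E ∈ neronSeveriLieAlgebra Φ :=
  countingG_mem_llAlgebra (hη₀.mem_neronSeveriR' Φ) (isSl2Triple (hη₀.nondegenerate'' Φ))

/-! ### §2 Only the degrees `-2, 0, 2` occur in `(𝔤_NS(X; ℝ), h)`; `𝔤_2` is abelian -/

/-- **`𝔤_c(h) = 0` in `𝔤_NS(X; ℝ)` for `c ∉ {-2, 0, 2}`** — inherited from `𝔤_tot(X; ℝ) ⊇ 𝔤_NS(X; ℝ)` (row A1-211).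
[cite: LooijengaLunts1997, §3 (3.6) p. 14 L70–L71 ("The Néron–Severi Lie algebra of the abelian variety X is of Jordan type")] -/
theorem IsRiemannForm.adDegree_neronSeveriLieAlgebra_eq_bot (hη₀ : IsRiemannForm Φ η₀) {c : ℝ} (h2 : c ≠ 2)
    (h0 : c ≠ 0) (hn2 : c ≠ -2) :
    adDegree ℝ (⟨countingG E, hη₀.countingG_mem_neronSeveriLieAlgebra' Φ⟩ : neronSeveriLieAlgebra Φ) c = ⊥ := by
  refine (Submodule.eq_bot_iff _).2 fun T hT ↦ ?_
  have h1 := mem_adDegree_iff.1 hT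
  have h2' : ⁅countingG E, (T : Module.End ℂ (GForm E ℂ))⁆ = c • (T : Module.End ℂ (GForm E ℂ)) :=
    congrArg Subtype.val h1
  have hT' : (⟨(T : Module.End ℂ (GForm E ℂ)), neronSeveriLieAlgebra_le_totalLieAlgebra Φ T.2⟩ : totalLieAlgebra E) ∈
      adDegree ℝ (⟨countingG E, countingG_mem_totalLieAlgebra' E⟩ : totalLieAlgebra E) c :=
    mem_adDegree_iff.2 (Subtype.ext h2')
  rw [adDegree_totalLieAlgebra_eq_bot E h2 h0 hn2, Submodule.mem_bot] at hT'
  have h3 : (T : Module.End ℂ (GForm E ℂ)) = 0 := congrArg Subtype.val hT'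
  exact Subtype.ext h3

/-- **`𝔤_2` of `𝔤_NS(X; ℝ)` is abelian.** [cite: LooijengaLunts1997, §2 (2.2) p. 9 L116, §3 (3.6)] -/
theorem IsRiemannForm.lie_eq_zero_of_mem_adDegree_two_neronSeveriLieAlgebra (hη₀ : IsRiemannForm Φ η₀)
    {a b : neronSeveriLieAlgebra Φ}
    (ha : a ∈ adDegree ℝ (⟨countingG E, hη₀.countingG_mem_neronSeveriLieAlgebra' Φ⟩ : neronSeveriLieAlgebra Φ) 2)
    (hb : b ∈ adDegree ℝ (⟨countingG E, hη₀.countingG_mem_neronSeveriLieAlgebra' Φ⟩ : neronSeveriLieAlgebra Φ) 2) :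
    ⁅a, b⁆ = 0 := by
  have h := lie_mem_adDegree ha hb
  rw [show (2 : ℝ) + 2 = 4 by norm_num, hη₀.adDegree_neronSeveriLieAlgebra_eq_bot Φ (by norm_num) (by norm_num)
    (by norm_num), Submodule.mem_bot] at h
  exact h

/-! ### §3 The `𝔰𝔩₂`-triples `(L_η, h, Λ_η)` inside `𝔤_NS(X; ℝ)` -/

/-- `L_η ∈ 𝔤_2` for every `η ∈ NS(X) ⊗ ℝ`. [cite: LooijengaLunts1997, §1 (1.1) p. 3 L106–L111, §3 (3.6) ("Its degree 2 summand is canonically isomorphic to NS(X) ⊗ ℚ")] -/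
theorem IsRiemannForm.lefschetzG_mem_adDegree_two_neronSeveriLieAlgebra (hη₀ : IsRiemannForm Φ η₀)
    {η : E [⋀^Fin 2]→L[ℝ] ℝ} (hη : η ∈ neronSeveriR Φ) :
    (⟨lefschetzG η, lefschetzG_mem_neronSeveriLieAlgebra Φ hη⟩ : neronSeveriLieAlgebra Φ) ∈
      adDegree ℝ (⟨countingG E, hη₀.countingG_mem_neronSeveriLieAlgebra' Φ⟩ : neronSeveriLieAlgebra Φ) 2 := by
  rw [mem_adDegree_iff]
  apply Subtype.ext
  change ⁅countingG E, lefschetzG η⁆ = (2 : ℝ) • lefschetzG η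
  rw [lie_countingG_lefschetzG, two_smul, two_smul]

/-- For a non-degenerate `η ∈ NS(X) ⊗ ℝ`, `(L_η, h, Λ_η)` is an `𝔰𝔩₂`-triple INSIDE `𝔤_NS(X; ℝ)`. [cite: LooijengaLunts1997, §1 (1.1) p. 4 L1–L5, §3 (3.6)] -/
theorem IsRiemannForm.isSl2Triple_neronSeveriLieAlgebra (hη₀ : IsRiemannForm Φ η₀) {η : E [⋀^Fin 2]→L[ℝ] ℝ}
    (hη : η ∈ neronSeveriR Φ) (hnd : ∀ v : E, v ≠ 0 → ∃ w : E, η ![v, w] ≠ 0) :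
    IsSl2Triple (⟨countingG E, hη₀.countingG_mem_neronSeveriLieAlgebra' Φ⟩ : neronSeveriLieAlgebra Φ)
      ⟨lefschetzG η, lefschetzG_mem_neronSeveriLieAlgebra Φ hη⟩
      ⟨lefschetzDualG η, lefschetzDualG_mem_llAlgebra hη hnd⟩ := by
  letI : LieRing (Module.End ℂ (GForm E ℂ)) := LieRing.ofAssociativeRing
  have t := isSl2Triple hnd
  exact
    { h_ne_zero := fun h0 ↦ countingG_ne_zero (E := E) (congrArg Subtype.val h0)
      lie_e_f := Subtype.ext t.lie_e_f
      lie_h_e_nsmul := Subtype.ext t.lie_h_e_nsmul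
      lie_h_f_nsmul := Subtype.ext t.lie_h_f_nsmul }

/-- The polarisation itself gives a point of the domain of `f`: `L_{η₀} ∈ dom f`. [cite: LooijengaLunts1997, §1 p. 7 L54–L66, §3 (3.6)] -/
theorem IsRiemannForm.lefschetzG_mem_lefschetzDomain_neronSeveriLieAlgebra (hη₀ : IsRiemannForm Φ η₀) :
    (⟨lefschetzG η₀, lefschetzG_mem_neronSeveriLieAlgebra Φ (hη₀.mem_neronSeveriR' Φ)⟩ : neronSeveriLieAlgebra Φ) ∈
      lefschetzDomain ℝ (⟨countingG E, hη₀.countingG_mem_neronSeveriLieAlgebra' Φ⟩ : neronSeveriLieAlgebra Φ)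
        (adDegree ℝ (⟨countingG E, hη₀.countingG_mem_neronSeveriLieAlgebra' Φ⟩ : neronSeveriLieAlgebra Φ) 2) :=
  mem_lefschetzDomain_iff.2 ⟨hη₀.lefschetzG_mem_adDegree_two_neronSeveriLieAlgebra Φ (hη₀.mem_neronSeveriR' Φ), _,
    hη₀.isSl2Triple_neronSeveriLieAlgebra Φ (hη₀.mem_neronSeveriR' Φ) (hη₀.nondegenerate'' Φ)⟩

/-! ### §4 `(𝔤_NS(X; ℝ), h)` is a Jordan–Lefschetz pair over `ℝ` -/

/-- **Generation**: `𝔤_NS(X; ℝ) = 𝔤(NS(X) ⊗ ℝ, H•(X))` is, by DEFINITION (`llAlgebra`), generated by the `e_a`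
(`a ∈ NS(X) ⊗ ℝ`, all in `𝔤_2`) and the `f_a` (all in the image of `f`). [cite: LooijengaLunts1997, §1 p. 7 L64–L66, (1.1) p. 4 L34–L37, (1.9)] -/
theorem IsRiemannForm.lieSpan_adDegree_two_union_lefschetzDuals_neronSeveriLieAlgebra (hη₀ : IsRiemannForm Φ η₀) :
    LieSubalgebra.lieSpan ℝ (neronSeveriLieAlgebra Φ)
        ((adDegree ℝ (⟨countingG E, hη₀.countingG_mem_neronSeveriLieAlgebra' Φ⟩ : neronSeveriLieAlgebra Φ) 2 :
            Set (neronSeveriLieAlgebra Φ)) ∪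
          lefschetzDuals ℝ (⟨countingG E, hη₀.countingG_mem_neronSeveriLieAlgebra' Φ⟩ : neronSeveriLieAlgebra Φ)
            (adDegree ℝ (⟨countingG E, hη₀.countingG_mem_neronSeveriLieAlgebra' Φ⟩ : neronSeveriLieAlgebra Φ) 2)) =
      ⊤ := by
  letI : LieRing (Module.End ℂ (GForm E ℂ)) := LieRing.ofAssociativeRing
  set hN : neronSeveriLieAlgebra Φ := ⟨countingG E, hη₀.countingG_mem_neronSeveriLieAlgebra' Φ⟩ with hhN
  set S := LieSubalgebra.lieSpan ℝ (neronSeveriLieAlgebra Φ)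
    ((adDegree ℝ hN 2 : Set (neronSeveriLieAlgebra Φ)) ∪ lefschetzDuals ℝ hN (adDegree ℝ hN 2)) with hS
  have hle : neronSeveriLieAlgebra Φ ≤ S.map (neronSeveriLieAlgebra Φ).incl := by
    refine LieSubalgebra.lieSpan_le.2 ?_
    rintro T ⟨η, hη, hT⟩
    rcases hT with rfl | t
    · exact ⟨⟨lefschetzG η, lefschetzG_mem_neronSeveriLieAlgebra Φ hη⟩,
        LieSubalgebra.subset_lieSpan (Or.inl (hη₀.lefschetzG_mem_adDegree_two_neronSeveriLieAlgebra Φ hη)), rfl⟩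
    · have t' : IsSl2Triple hN ⟨lefschetzG η, lefschetzG_mem_neronSeveriLieAlgebra Φ hη⟩
          ⟨T, mem_llAlgebra_of_isSl2Triple hη t⟩ :=
        { h_ne_zero := fun h0 ↦ countingG_ne_zero (E := E) (congrArg Subtype.val h0)
          lie_e_f := Subtype.ext t.lie_e_f
          lie_h_e_nsmul := Subtype.ext t.lie_h_e_nsmul
          lie_h_f_nsmul := Subtype.ext t.lie_h_f_nsmul }
      exact ⟨⟨T, mem_llAlgebra_of_isSl2Triple hη t⟩,
        LieSubalgebra.subset_lieSpan (Or.inr (mem_lefschetzDuals_iff.2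
          ⟨_, hη₀.lefschetzG_mem_adDegree_two_neronSeveriLieAlgebra Φ hη, t'⟩)), rfl⟩
  refine eq_top_iff.2 fun x _ ↦ ?_
  obtain ⟨y, hy, hyx⟩ := hle x.2
  have hyx' : y = x := Subtype.ext hyx
  rw [← hyx']
  exact hy

/-- **Looijenga–Lunts (3.6): `(𝔤_NS(X; ℝ), h)` IS A JORDAN–LEFSCHETZ PAIR over `ℝ`** for every polarised abelian variety
`(X, η₀)` ("The Néron–Severi Lie algebra of the abelian variety `X` is of Jordan type"): semisimple (tree
`IsRiemannForm.isSemisimple_neronSeveriLieAlgebra`), `𝔞 = 𝔤_2` abelian (§2), the triple `(L_{η₀}, h, Λ_{η₀})` (§3),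
generation (§4). [cite: LooijengaLunts1997, §3 (3.6) p. 14 L70–L76 ("The Néron–Severi Lie algebra of the abelian variety X is of Jordan type. Its degree 2 summand is canonically isomorphic to NS(X) ⊗ ℚ …")] -/
theorem IsRiemannForm.isJordanLefschetzPair_neronSeveriLieAlgebra [Fintype ι] [DecidableEq ι]
    (hη₀ : IsRiemannForm Φ η₀) :
    IsJordanLefschetzPair ℝ (⟨countingG E, hη₀.countingG_mem_neronSeveriLieAlgebra' Φ⟩ : neronSeveriLieAlgebra Φ) :=
  ⟨hη₀.isSemisimple_neronSeveriLieAlgebra Φ, le_rfl,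
    fun _ ha _ hb ↦ hη₀.lie_eq_zero_of_mem_adDegree_two_neronSeveriLieAlgebra Φ ha hb,
    ⟨_, hη₀.lefschetzG_mem_lefschetzDomain_neronSeveriLieAlgebra Φ⟩,
    hη₀.lieSpan_adDegree_two_union_lefschetzDuals_neronSeveriLieAlgebra Φ⟩

/-- Hence `(𝔤_NS(X; ℝ), h)` is a Lefschetz pair. [cite: LooijengaLunts1997, §1 p. 7 L77–L78, §3 (3.6)] -/
theorem IsRiemannForm.isLefschetzPair_neronSeveriLieAlgebra [Fintype ι] [DecidableEq ι] (hη₀ : IsRiemannForm Φ η₀) :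
    IsLefschetzPair ℝ (⟨countingG E, hη₀.countingG_mem_neronSeveriLieAlgebra' Φ⟩ : neronSeveriLieAlgebra Φ) :=
  (hη₀.isJordanLefschetzPair_neronSeveriLieAlgebra Φ).isLefschetzPair

/-- **The abelian-variety form**: for every abelian variety `X` (some polarisation exists), `h ∈ 𝔤_NS(X; ℝ)` and
`(𝔤_NS(X; ℝ), h)` is a Jordan–Lefschetz pair. [cite: LooijengaLunts1997, §3 (3.6) p. 14 L70–L71] -/
theorem IsAbelianVariety.exists_isJordanLefschetzPair_neronSeveriLieAlgebra [Fintype ι] [DecidableEq ι]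
    (hX : IsAbelianVariety Φ) :
    ∃ hh : countingG E ∈ neronSeveriLieAlgebra Φ,
      IsJordanLefschetzPair ℝ (⟨countingG E, hh⟩ : neronSeveriLieAlgebra Φ) := by
  obtain ⟨η₀, hη₀⟩ := hX
  exact ⟨hη₀.countingG_mem_neronSeveriLieAlgebra' Φ, hη₀.isJordanLefschetzPair_neronSeveriLieAlgebra Φ⟩

end Literature.Geometry.Kaehler.ComplexTorus
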